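import Literature.Computability.Cryptography.PeikertSamplerVecMachine
import Literature.Computability.Cryptography.PeikertPerturbationUnit
import Literature.Computability.Cryptography.SISOddPartMachine
import Literature.Algebra.EuclideanLattices.BabaiListProgram
import Literature.Algebra.EuclideanLattices.GapInstanceCodeFP
import Literature.Probability.Distributions.PseudoGaussianSamplerParams
import HarnessLib

/-!
# The machine of Peikert's `GapSVP → BDD` reduction: specification of its queries and its verdict

Topic `Computability/Cryptography` (family `pqc`). The first component `h₁` of
`peikert_gapSVPZeta_to_lwe_classical_of_components` (`PeikertReduction.lean`, named fact
`Literature.Computability.Cryptography.peikert_gapSVPZeta_to_lwe_classical`, pqc.S20) asks for ONE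
polynomial-time oracle machine `M` deciding `GapSVP_{ζ,γ}` given any `BDD` solver. `M` is the truth-table
decider `ttAlgL Q q D` of `Complexity/TruthTableDecidersL.lean` run with the solver as a randomised
subroutine (`exists_polyTime_ttRandDecider`); this file SPECIFIES, as total functions of typed data,
its query map (`query`: iteration `j` reads coin block `j`, samples the perturbation `w_j`
(`samplerVecOf`, `PseudoGaussianSampler*.lean`), reduces it to Babai's residual `x_j` w.r.t. the scaled
basis `M·B` (`Babai.residualL`), writes the `GapCVP` code `u_j` of `((M·B, x_j), r)` (`GapCodes.cvpCode`)
and hands the solver its coins `c_j`) and its verdict map (`verdict`: accept iff `d ≥ 1` and some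
answer does NOT decode (`decodeIntVec`, in the closed form of `SISOddPartMachine.lean`) to
`x_j - w_j`). Their polynomial-time computability (typed `FP`) and the analysis are the sequel files.
Everything here is a DEFINITION with a body plus small unfolding lemmas; no named fact.

## The parameters (`√(log n)`-free regime of `PeikertPerturbationUnit.lean`)

For an instance `(B, d)` of dimension `n`, modulus `q = q(n)` and rational noise rate `a = a(n)`:
precision `m = size n + 80` (so `2^m ≤ 2^81 n`: the sampler's `2^{Θ(m)}` coins stay polynomial and
its statistical error `n·8·2^{-m} ≤ 2^{-76}` is below every constant of the analysis); scaling
`M = 2^{m + r(m) + 4}`; mesh `b = ⌊log₂ Y⌋/2 = (size Y - 1)/2`, `Y = ⌊M²·num(d)²/(32·den(d)²)⌋`, so that the sampler's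
width `σ₀ = 2ᵇ/√2 ∈ (Md/16, Md/8]`; the BDD radius `r = (2t+1)/2^{K+1} ∈ [A, 4A/3] ⊆ (r₀, 2r₀]`,
`A = q·a·(⌊√(2n)⌋+1)/(2n·M·d)`, an odd numerator over a power of two being automatically in lowest
terms; `N₀ = ⌈4/hidingAdvantage⌉` iterations.

## References

* C. Peikert, *Public-key cryptosystems from the worst-case shortest vector problem*, STOC 2009, proof
  of Thm. 3.1 (the reduction, full version Dagstuhl 08491 p. 12) [Peikert2009].
* S. Arora, B. Barak, *Computational Complexity: A Modern Approach*, CUP 2009, §1.3, Def. 7.1 [AroraBarak2009].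
-/

noncomputable section

namespace Literature.Computability.Cryptography

namespace Peikert2009

open Literature.Algebra.EuclideanLattices Literature.Algebra.EuclideanLattices.GapCodes
  Literature.Probability.Distributions Literature.Computability.Complexity Polynomial
  Literature.Computability.Cryptography.SIS.OddPartFP

namespace Spec

/-! ### The typed input: instance, modulus, rational noise rate -/

/-- The typed data the machine works with: the instance `p = (B, d)`, the modulus `q(n)` and the noise
rate `a(n) = anum/aden`. [cite: Peikert2009, Thm. 3.1 proof] -/
abbrev Inp : Type := GapSVPInstance × (ℕ × (ℤ × ℕ))

variable (ι : Inp)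

/-- The dimension. [folklore] -/
abbrev dim : ℕ := ι.1.1.n
/-- The modulus `q(n)`. [folklore] -/
abbrev qv : ℕ := ι.2.1
/-- Numerator of the noise rate `a(n)`. [folklore] -/
abbrev anum : ℤ := ι.2.2.1
/-- Denominator of the noise rate `a(n)`. [folklore] -/
abbrev aden : ℕ := ι.2.2.2
/-- Numerator of the threshold `d`. [folklore] -/
abbrev dnum : ℤ := ι.1.2.num
/-- Denominator of the threshold `d`. [folklore] -/
abbrev dden : ℕ := ι.1.2.den

/-! ### Scalar parameters -/

/-- The precision `m = size n + 80` (`size n = ⌊log₂ n⌋ + 1` for `n ≥ 1`, the binary length). [cite: Peikert2009, Thm. 3.1 proof] -/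
def prec (n : ℕ) : ℕ := 80 + Nat.size n

/-- The scaling `M = 2^{m + r(m) + 4}`. [cite: Peikert2009, Thm. 3.1 proof] -/
def scale (n : ℕ) : ℕ := 2 ^ (prec n + PGParams.rOf (prec n) + 4)

/-- `Y = ⌊M² num(d)² / (32 den(d)²)⌋`. [folklore] -/
def yOf : ℕ := scale (dim ι) ^ 2 * (dnum ι).natAbs ^ 2 / (32 * dden ι ^ 2)

/-- The mesh exponent `b = (size Y - 1) / 2 = ⌊log₂ Y⌋ / 2` (`4ᵇ ≤ Y < 4^{b+1}` for `Y ≥ 1`). [folklore] -/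
def mesh : ℕ := (Nat.size (yOf ι) - 1) / 2

/-- The sampler's parameters `std m b`. [folklore] -/
def params : PGParams := PGParams.std (prec (dim ι)) (mesh ι)

/-- The scaled basis rows `M · B` as lists. [cite: Peikert2009, Thm. 3.1 proof] -/
def sRows : List (List ℤ) := (matRows ι.1.1.basis).map fun row => row.map fun z => (scale (dim ι) : ℤ) * z

/-- Numerator of `A = q·a·(⌊√(2n)⌋+1)/(2n·M·d)`. [folklore] -/
def numA : ℕ := qv ι * (anum ι).natAbs * (Nat.sqrt (2 * dim ι) + 1) * dden ι

/-- Denominator of `A`. [folklore] -/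
def denA : ℕ := 2 * dim ι * scale (dim ι) * aden ι * (dnum ι).natAbs

/-- The dyadic exponent `K = size (3 denA)` (`2^K > 3 denA`). [folklore] -/
def kExp : ℕ := Nat.size (3 * denA ι)

/-- `t`: the least natural with `(2t+1)/2^{K+1} ≥ A`, i.e. `⌈(numA·2^{K+1} - denA)/(2 denA)⌉`. [folklore] -/
def tNum : ℕ := (numA ι * 2 ^ (kExp ι + 1) + denA ι - 1) / (2 * denA ι)

/-- Numerator `2t + 1` of the BDD radius `r`. [folklore] -/
def rNum : ℤ := 2 * (tNum ι : ℤ) + 1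

/-- Denominator `2^{K+1}` of `r`. [folklore] -/
def rDen : ℕ := 2 ^ (kExp ι + 1)

/-- The BDD radius `r = (2t+1)/2^{K+1}` (in lowest terms: odd over a power of two). [cite: Peikert2009, Thm. 3.1 proof] -/
def rRat : ℚ := (rNum ι : ℚ) / (rDen ι : ℚ)

/-! ### Coin layout -/

/-- An a-priori bound on the entries of the BDD target `x = residual(w)`: `n·M·∑|Bᵢⱼ| + 1`
(`‖residual‖ ≤ ½√(∑‖M bᵢ‖²) ≤ ½ n M max|Bᵢⱼ|`). [folklore] -/
def entryBound : ℕ := dim ι * scale (dim ι) * ((rowMajor (dim ι) (matRows ι.1.1.basis)).map Int.natAbs).sum + 1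

/-- An a-priori bound on the length of the query code `u`. [folklore] -/
def uBound : ℕ := (cvpCode (dim ι) (sRows ι) (List.replicate (dim ι) (entryBound ι : ℤ)) (rNum ι) (rDen ι)).length

variable (coinsR : Polynomial ℕ)

/-- The tail of a coin block reserved for the solver's coins: `coinsR (uBound)` bits. [folklore] -/
def tailLen : ℕ := coinsR.eval (uBound ι)

/-- The length of one coin block: `n · coinLen` sampler coins, then the tail. [folklore] -/
def blockLen : ℕ := (params ι).coinLen * dim ι + tailLen ι coinsR

/-- Coin block `j`. [cite: AroraBarak2009, Def. 7.1] -/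
def block (r : List Bool) (j : ℕ) : List Bool := chunk (blockLen ι coinsR) r j

/-! ### One iteration -/

/-- The perturbation `w_j ∈ ℤⁿ` sampled from block `j`. [cite: Peikert2009, Thm. 3.1 proof (step 1)] -/
def wL (r : List Bool) (j : ℕ) : List ℤ :=
  Literature.Computability.Cryptography.samplerVecOf (params ι).ctx (dim ι) (params ι).coinLen (block ι coinsR r j)

/-- The BDD target `x_j`: Babai's residual of `w_j` w.r.t. the scaled rows. [cite: Peikert2009, Thm. 3.1 proof (step 2: `x = w mod B`)] -/
def xL (r : List Bool) (j : ℕ) : List ℤ := Babai.residualL (sRows ι) (wL ι coinsR r j) (dim ι)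

/-- The query code `u_j = code ((M·B, x_j), r)`. [cite: Peikert2009, Thm. 3.1 proof (step 3)] -/
def uStr (r : List Bool) (j : ℕ) : List Bool := cvpCode (dim ι) (sRows ι) (xL ι coinsR r j) (rNum ι) (rDen ι)

/-- The solver's coins `c_j`: the first `coinsR |u_j|` bits of the tail of block `j`. [cite: AroraBarak2009, Def. 7.1] -/
def cStr (r : List Bool) (j : ℕ) : List Bool :=
  ((block ι coinsR r j).drop ((params ι).coinLen * dim ι)).take (coinsR.eval (uStr ι coinsR r j).length)

/-- **The query of iteration `j`**: `⟨u_j, c_j⟩`. [cite: Peikert2009, Thm. 3.1 proof] -/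
def query (r : List Bool) (j : ℕ) : List Bool := boolPair (uStr ι coinsR r j) (cStr ι coinsR r j)

/-- The expected answer `x_j - w_j`. [cite: Peikert2009, Thm. 3.1 proof (step 4)] -/
def vL (r : List Bool) (j : ℕ) : List ℤ := List.zipWith (· - ·) (xL ι coinsR r j) (wL ι coinsR r j)

/-! ### The verdict -/

/-- **Does the answer `a` decode to the vector listed by `v`?** — the closed form of
`decodeIntVec n a = v` (`decodeIntVec_eq`): both headers announce `n` and the entries agree, or a
header is wrong and `v = 0`. [cite: AroraBarak2009, §0.1] -/
def ansOK (n : ℕ) (v : List ℤ) (a : List Bool) : Bool :=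
  if hdrOf a = n ∧ lenOf a = n then (List.range n).all fun i => decide ((entriesOf n a).getD i 0 = v.getD i 0)
  else (List.range n).all fun i => decide (v.getD i 0 = 0)

/-- The number of iterations `N₀ = ⌈4/hidingAdvantage⌉` (an absolute constant). [cite: Peikert2009, Thm. 3.1 proof] -/
def iters : ℕ := ⌈4 / hidingAdvantage⌉₊

/-- **The verdict** on the coins `r` and the answers `[a₀, …]`: accept iff `d ≥ 1` and some iteration's
answer does not decode to `x_j - w_j`. [cite: Peikert2009, Thm. 3.1 proof (step 4)] -/
def verdict (r : List Bool) (as : List (List Bool)) : Bool :=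
  decide ((dden ι : ℤ) ≤ dnum ι) &&
    (List.range iters).any fun j => !ansOK (dim ι) (vL ι coinsR r j) (as.getD j [])

/-! ### Unfoldings -/

/-- `ansOK n (ofFn v) a ↔ decodeIntVec n a = v`. [cite: AroraBarak2009, §0.1] -/
theorem ansOK_ofFn_iff (n : ℕ) (v : Fin n → ℤ) (a : List Bool) :
    ansOK n (List.ofFn v) a = true ↔ decodeIntVec n a = v := by
  have hget : ∀ i : Fin n, (List.ofFn v).getD i 0 = v i := fun i => by
    simp [List.getD_eq_getElem?_getD]
  rw [decodeIntVec_eq, ansOK]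
  by_cases h : hdrOf a = n ∧ lenOf a = n
  · rw [if_pos h, if_pos h, List.all_eq_true]
    constructor
    · intro H
      funext i
      have := H i (List.mem_range.2 i.isLt)
      rw [decide_eq_true_eq, hget] at this
      exact this
    · intro H i hi
      rw [decide_eq_true_eq]
      have := congrFun H ⟨i, List.mem_range.1 hi⟩
      rw [hget ⟨i, List.mem_range.1 hi⟩]
      exact this
  · rw [if_neg h, if_neg h, List.all_eq_true]
    constructor
    · intro H
      funext i
      have := H i (List.mem_range.2 i.isLt)
      rw [decide_eq_true_eq, hget] at this
      simp [this]
    · intro H i hi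
      rw [decide_eq_true_eq]
      have := congrFun H ⟨i, List.mem_range.1 hi⟩
      rw [hget ⟨i, List.mem_range.1 hi⟩]
      simpa using this.symm

/-- The lengths of `wL`, `xL`, `vL` are `n`. [folklore] -/
theorem length_wL (r : List Bool) (j : ℕ) : (wL ι coinsR r j).length = dim ι := length_samplerVecOf _ _ _ _

/-- The lengths of `wL`, `xL`, `vL` are `n`. [folklore] -/
theorem length_xL (r : List Bool) (j : ℕ) : (xL ι coinsR r j).length = dim ι := Babai.length_residualL _ _ _

/-- The lengths of `wL`, `xL`, `vL` are `n`. [folklore] -/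
theorem length_vL (r : List Bool) (j : ℕ) : (vL ι coinsR r j).length = dim ι := by
  rw [vL, List.length_zipWith, length_xL, length_wL, min_self]

/-- `r` is positive. [folklore] -/
theorem rRat_pos : 0 < rRat ι := by
  unfold rRat rNum rDen
  positivity

/-- **`r` is in lowest terms**: `num r = 2t + 1`, `den r = 2^{K+1}`. [folklore] -/
theorem rRat_num_den : (rRat ι).num = rNum ι ∧ (rRat ι).den = rDen ι := by
  have hcop : Nat.Coprime (2 * tNum ι + 1) (2 ^ (kExp ι + 1)) :=
    Nat.Coprime.pow_right _ (Nat.coprime_comm.1 ((Nat.Prime.coprime_iff_not_dvd Nat.prime_two).2 (by omega)))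
  have hq : rRat ι = ((2 * tNum ι + 1 : ℕ) : ℚ) / ((2 ^ (kExp ι + 1) : ℕ) : ℚ) := by
    unfold rRat rNum rDen; push_cast; ring
  have hnum := Rat.num_div_eq_of_coprime (a := ((2 * tNum ι + 1 : ℕ) : ℤ)) (b := ((2 ^ (kExp ι + 1) : ℕ) : ℤ))
    (by positivity) (mod_cast hcop)
  have hden := Rat.den_div_eq_of_coprime (a := ((2 * tNum ι + 1 : ℕ) : ℤ)) (b := ((2 ^ (kExp ι + 1) : ℕ) : ℤ))
    (by positivity) (mod_cast hcop)
  push_cast at hnum hden hq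
  rw [hq]
  refine ⟨?_, ?_⟩
  · rw [hnum, rNum]
  · rw [rDen]; exact_mod_cast hden

end Spec

end Peikert2009

end Literature.Computability.Cryptography

end
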